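import Literature.MathematicalPhysics.QuantumFieldTheory.Balaban1983to89.B9Thm311CubeLettersGCoercive

/-!
# `Balaban1983to89.B9Thm311CubeLettersGCoerciveGauge` — [B9] Cor. 3.6 p. 408 ∕ Thm 3.11 p. 416 FOR THE CUBE LETTERS, THE QUANTITATIVE HALF OF THE GAUGE
# ROAD: a COERCIVITY CONSTANT (not only positivity) of `Δ_{a,□}` is invariant along unitary gauge orbits («all the results of these theorems are gauge
# invariant»), so the `L²` conclusions of `B9Thm311CubeLettersGCoercive` obtained at the gauge-fixed `U^u = e^{iηA}` — `(1 − θ)m⟨C,C⟩ ≦ ⟨C, Δ_{a,□}C⟩`,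
# `(1 − θ)m⟨B, G_□B⟩ ≦ ⟨B,B⟩`, `((1 − θ)m)²‖G_□B‖² ≦ ‖B‖²` — HOLD AT THE ORIGINAL (3.35)-configuration `U` with the SAME constants

statement-level skeleton of published theorems with citation tags; proofs where landed; nothing here is a claim about the Yang–Mills mass gap

T. Bałaban, *Propagators for lattice gauge theories in a background field*, Commun. Math. Phys. **99** (1985) 389–434 [`Balaban1985BackgroundPropagators`,
"[B9]"; held text `paper:balaban1985-cmp99-background-propagators`, journal page = PDF page + 388; pp. 395–396, 407–408, 416 read first-hand].

THE PRINT (verbatim).  p. 396 (3.34): «Δ_a(U^u) = R(u)Δ_a(U)R(u⁻¹), G(U^u) = R(u)G(U)R(u⁻¹)»; p. 398: «All these inequalities are invariant with respect to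
gauge transformations of U.»; p. 408 (Cor. 3.6, proof): «This follows from Corollary 3.5 applied to the configuration U′ = U^u, and we have to recall only
that all the results of these theorems are gauge invariant.»; p. 416: «Doing the gauge transformation we get the configuration U = e^{iηA} with A small,
and by (3.86) we get G_□(e^{iηA}) = G_□(1)(I − V(A)G_□(1))⁻¹.»

WHY THIS FILE.  `B9Thm311CubeLettersGCoercive` (✓ p620365, this seat) proves the `L²` layer of (3.84)–(3.86) WITH CONSTANTS at the gauge-fixed configuration
`U′` and fires r05's road `GACubeY_parSymY_posDefTr_of_smallFieldGauge` back to the original `U` — but that road (dag-n06-j's `posDefTr_iff_of_intw_conjY`)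
transports POSITIVITY only.  Print's remark transports every inequality.  THIS FILE adds the one-line reason in the trace currency — a coercivity constant
descends along a unitary `R(u)`-intertwining because `R(u)` is a `trIP`-isometry (dag-n06-j's `trIP_one_conjY_conjY`) — and reads it at r05's cube letters
(g80's (3.34) `deltaACubeY_cov`): Theorem 3.11 WITH ITS CONSTANT and the `L²` size of `G_□(U)` at the original `U` from the two displayed inputs of
p620365 ((i) flat coercivity `m`, (ii) the first-order relative bound of `V(A)` in the gauge `u`).

WHAT IS PROVED (sorry-free; 0 `def`; `M_N(ℂ)` fibres, weight `1`).
* §1 `coercive_of_intw_conjY` (a coercivity constant descends along `T′∘R(u) = R(u)∘T`, `u` unitary-valued), `coercive_iff_of_intw_conjY`.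
* §2 at r05's cube letters (lawful transporters, in particular `parSymY ∕ parBY`): ★★ `deltaACubeY_coercive_gaugeY_iff` (the constant is an orbit invariant),
  ★★★ `deltaACubeY_parSymY_coercive_of_relBoundGauge` (`(1 − θ)m⟨C,C⟩ ≦ ⟨C, Δ_{a,□}(U)C⟩` at the ORIGINAL `U` from (i)+(ii) in a unitary-valued gauge, `θ ≦ 1`),
  ★★★ `GACubeY_parSymY_bounds_of_relBoundGauge` (`θ < 1`: `Δ_{a,□}(U) > 0`, `IsUnit`, `G_□(U) > 0`, `(1 − θ)m⟨B, G_□(U)B⟩ ≦ ⟨B,B⟩`, `((1 − θ)m)²‖G_□(U)B‖² ≦ ‖B‖²`).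

HONEST SCOPE.  Bookkeeping over landed letters (isometry of the pairing + (3.34)); inputs (i), (ii) displayed exactly as in p620365; the gauge `u` is a
hypothesis (print's (3.35) gauge on `□̃⁵`; r05's caveat on torus-vs-cube gauges in `B9Thm311CubeLettersG` applies verbatim); `L²` only; count-neutral; NOT a
node discharge; no summit ∕ sub-problem claim (rungs R3∕R4 conditional; nothing continuum ∕ OS ∕ mass gap; not Clay).  No `sorry`∕`axiom`∕`instance`∕`notation`;
NEW file.  Seat `ym-inputs-p02` (prover-ym-inputs-p02-0), cell `pub/ym-inputs`, 2026-08-28.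
-/

namespace Literature.MathematicalPhysics.QuantumFieldTheory.Balaban1983to89.B9Thm311CubeLettersGCoerciveGauge

open B9Thm311ReadingCoords B9Thm311DeltaPrimePos B9Thm31SiteGpBoundsReg335Y Node00 B9CubeLettersBondOpsL0
  B9CubeLettersBondOpsAtOneIdentL0 B9CubeLettersCovarianceL0 B9Thm311DeltaAGaugeOrbit B9Thm311CubeLettersG B9Thm311CubeLettersGCoercive
  B9Thm311AdjointAtLetters
open Literature.MathematicalPhysics.QuantumFieldTheory.Balaban1983to89.B6KLevelCensusIndexV1 (KIdx)
open Literature.MathematicalPhysics.QuantumFieldTheory.Balaban1983to89.B6Cover236MultiLevelBlocks (cubes)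
open scoped Matrix

noncomputable section

/-! ## §1 A coercivity constant descends along a unitary intertwining -/

section Generic

open scoped Matrix.Norms.L2Operator

variable {N : ℕ} {S : Type} [Fintype S]

/-- **A COERCIVITY CONSTANT DESCENDS ALONG AN `R(u)`-INTERTWINING** `T′∘R(u) = R(u)∘T` (`u` unitary-valued): `c⟨Φ,Φ⟩₁ ≦ ⟨Φ, T′Φ⟩₁` for all `Φ` implies the
same for `T` — `R(u)` is an isometry of the trace pairing (`trIP_one_conjY_conjY`).  The quantitative twin of dag-n06-j's `posDefTr_of_intw_conjY`.
[cite: Balaban1985BackgroundPropagators, (3.34) p.396, p.398 («invariant with respect to gauge transformations»), Cor. 3.6 p.408] -/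
theorem coercive_of_intw_conjY {γ : S → (Matrix (Fin N) (Fin N) ℂ)ˣ} (hγ : ∀ s, ((γ s : (Matrix (Fin N) (Fin N) ℂ)ˣ) : Matrix (Fin N) (Fin N) ℂ) ∈ unitary _)
    {T T' : (S → Matrix (Fin N) (Fin N) ℂ) →ₗ[ℂ] (S → Matrix (Fin N) (Fin N) ℂ)} (h : Intw (conjY γ) (conjY γ) T T') {c : ℝ}
    (hT' : ∀ Φ, c * trIP (fun _ => (1 : ℝ)) Φ Φ ≤ trIP (fun _ => (1 : ℝ)) Φ (T' Φ)) (Φ : S → Matrix (Fin N) (Fin N) ℂ) :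
    c * trIP (fun _ => (1 : ℝ)) Φ Φ ≤ trIP (fun _ => (1 : ℝ)) Φ (T Φ) := by
  rw [← trIP_one_conjY_conjY γ hγ Φ (T Φ), ← h.apply Φ, ← trIP_one_conjY_conjY γ hγ Φ Φ]
  exact hT' _

/-- … and ascends (apply the descent to `u⁻¹`): the coercivity constants of `T` and `T′` agree. [cite: Balaban1985BackgroundPropagators, (3.34) p.396, Cor. 3.6 p.408] -/
theorem coercive_iff_of_intw_conjY {γ : S → (Matrix (Fin N) (Fin N) ℂ)ˣ} (hγ : ∀ s, ((γ s : (Matrix (Fin N) (Fin N) ℂ)ˣ) : Matrix (Fin N) (Fin N) ℂ) ∈ unitary _)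
    {T T' : (S → Matrix (Fin N) (Fin N) ℂ) →ₗ[ℂ] (S → Matrix (Fin N) (Fin N) ℂ)} (h : Intw (conjY γ) (conjY γ) T T') {c : ℝ} :
    (∀ Φ, c * trIP (fun _ => (1 : ℝ)) Φ Φ ≤ trIP (fun _ => (1 : ℝ)) Φ (T Φ)) ↔ ∀ Φ, c * trIP (fun _ => (1 : ℝ)) Φ Φ ≤ trIP (fun _ => (1 : ℝ)) Φ (T' Φ) := by
  refine ⟨fun hT => ?_, fun hT' => coercive_of_intw_conjY hγ h hT'⟩
  have hγ' : ∀ s, ((γ⁻¹ s : (Matrix (Fin N) (Fin N) ℂ)ˣ) : Matrix (Fin N) (Fin N) ℂ) ∈ unitary _ := fun s => by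
    rw [Pi.inv_apply, val_inv_eq_conjTranspose _ (hγ s), ← Matrix.star_eq_conjTranspose]
    exact Unitary.star_mem (hγ s)
  have h1 : ∀ Φ : S → Matrix (Fin N) (Fin N) ℂ, conjY γ⁻¹ (conjY γ Φ) = Φ := fun Φ => by
    rw [← LinearMap.comp_apply, ← conjY_mul, inv_mul_cancel, conjY_one, LinearMap.id_apply]
  have h2 : ∀ Ψ : S → Matrix (Fin N) (Fin N) ℂ, conjY γ (conjY γ⁻¹ Ψ) = Ψ := fun Ψ => by
    rw [← LinearMap.comp_apply, ← conjY_mul, mul_inv_cancel, conjY_one, LinearMap.id_apply]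
  have h' : Intw (conjY γ⁻¹) (conjY γ⁻¹) T' T := by
    refine LinearMap.ext fun Ψ => ?_
    rw [LinearMap.comp_apply, LinearMap.comp_apply]
    have h3 := h.apply (conjY γ⁻¹ Ψ)
    rw [h2] at h3
    rw [h3, h1]
  exact coercive_of_intw_conjY hγ' h' hT

end Generic

/-! ## §2 At r05's cube letters: the constant is an orbit invariant; Theorem 3.11 and the `L²` size of `G_□(U)` at the original `U` -/

section CubeLetters

open scoped Matrix.Norms.L2Operator

variable {d ℓ : ℕ} {hd : 1 ≤ d + 1} {hL : Odd (ℓ + 1) ∧ 1 < ℓ + 1} {b₀ b₁ : ℝ} {N : ℕ}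
variable (i : KIdx d ℓ hd hL b₀ b₁) (q : ↥(cubes (toKT i).D.toDomains)) {G : Subgroup (Matrix (Fin N) (Fin N) ℂ)ˣ}

/-- ★★ **THE COERCIVITY CONSTANT OF `Δ_{a,□}` IS CONSTANT ON GAUGE ORBITS** (lawful transporters; (3.34) `deltaACubeY_cov`): `c⟨C,C⟩ ≦ ⟨C, Δ_{a,□}(U^u)C⟩` for all
`C` iff the same at `U`, for every unitary-valued gauge transformation `u`. [cite: Balaban1985BackgroundPropagators, (3.34) p.396, p.398, Cor. 3.6 p.408] -/
theorem deltaACubeY_coercive_gaugeY_iff {parS : SiteParY (Matrix (Fin N) (Fin N) ℂ) i} {parB : BondParY (Matrix (Fin N) (Fin N) ℂ) i}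
    (hS : IsGaugeLawS i parS) (hB : IsGaugeLawB i parB) {u : GaugeY (Matrix (Fin N) (Fin N) ℂ) i}
    (hu : ∀ x, ((u x : (Matrix (Fin N) (Fin N) ℂ)ˣ) : Matrix (Fin N) (Fin N) ℂ) ∈ unitary _) (U : CfgY (Matrix (Fin N) (Fin N) ℂ) i) {c : ℝ} :
    (∀ C, c * trIP (fun _ => (1 : ℝ)) C C ≤ trIP (fun _ => (1 : ℝ)) C (deltaACubeY i q parS parB (gaugeY i u U) C)) ↔
      ∀ C, c * trIP (fun _ => (1 : ℝ)) C C ≤ trIP (fun _ => (1 : ℝ)) C (deltaACubeY i q parS parB U C) :=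
  (coercive_iff_of_intw_conjY (gBondY_mem_unitary i hu) (deltaACubeY_cov (g := u) (U := U) q hS hB)).symm

/-- ★★★ **THEOREM 3.11 FOR `Δ_{a,□}(U)` WITH ITS CONSTANT, ALONG PRINT's ROAD**: for a `G`-valued `U` (`G ≦ U(N)`), a `G`-valued gauge `u` («Doing the gauge
transformation …») at which, against a flat coercivity `m⟨C,C⟩ ≦ ⟨C, Δ_{a,□}(1)C⟩`, the remainder `V(A) = Δ_{a,□}(1) − Δ_{a,□}(U^u)` has a first-order relative
bound `(a, b)` with `θ = a∕m + b∕√m ≦ 1`, gives `(1 − θ)m·⟨C, C⟩ ≦ ⟨C, Δ_{a,□}(U)C⟩` AT THE ORIGINAL `U` (p620365's `deltaACubeY_coercive_of_relBound` at `U^u`,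
transported by `deltaACubeY_coercive_gaugeY_iff`). [cite: Balaban1985BackgroundPropagators, Thm 3.11 p.416, (3.84)–(3.86) p.407, Cor. 3.6 p.408, (3.34)–(3.35) p.396] -/
theorem deltaACubeY_parSymY_coercive_of_relBoundGauge (hG : G ≤ B7Prop2Explicit.unitaryUnits (Matrix (Fin N) (Fin N) ℂ))
    {U : CfgY (Matrix (Fin N) (Fin N) ℂ) i} {u : GaugeY (Matrix (Fin N) (Fin N) ℂ) i} (hu : ∀ x, u x ∈ G) {m a b : ℝ} (hm : 0 < m) (ha : 0 ≤ a) (hb : 0 ≤ b)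
    (hco : ∀ C, m * trIP (fun _ => (1 : ℝ)) C C ≤
      trIP (fun _ => (1 : ℝ)) C (deltaACubeY i q (parSymY i) (parBY i) (fun _ _ => 1 : CfgY (Matrix (Fin N) (Fin N) ℂ) i) C))
    (hrel : ∀ B C, |trIP (fun _ => (1 : ℝ)) B
        ((deltaACubeY i q (parSymY i) (parBY i) (fun _ _ => 1 : CfgY (Matrix (Fin N) (Fin N) ℂ) i) -
          deltaACubeY i q (parSymY i) (parBY i) (gaugeY i u U)) C)| ≤
      Real.sqrt (trIP (fun _ => (1 : ℝ)) B B) * (a * Real.sqrt (trIP (fun _ => (1 : ℝ)) C C) +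
        b * Real.sqrt (trIP (fun _ => (1 : ℝ)) C (deltaACubeY i q (parSymY i) (parBY i) (fun _ _ => 1 : CfgY (Matrix (Fin N) (Fin N) ℂ) i) C))))
    (hθ : a / m + b / Real.sqrt m ≤ 1) (C : FBondY i → Matrix (Fin N) (Fin N) ℂ) :
    ((1 - (a / m + b / Real.sqrt m)) * m) * trIP (fun _ => (1 : ℝ)) C C ≤ trIP (fun _ => (1 : ℝ)) C (deltaACubeY i q (parSymY i) (parBY i) U C) := by
  have hu' : ∀ x, ((u x : (Matrix (Fin N) (Fin N) ℂ)ˣ) : Matrix (Fin N) (Fin N) ℂ) ∈ unitary _ := fun x => hG (hu x)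
  have h := deltaACubeY_coercive_of_relBound i q (parSymY i) (parBY i) (fun _ _ => 1) (gaugeY i u U) hm ha hb hco hrel hθ
  exact (deltaACubeY_coercive_gaugeY_iff i q (parSymY_isGaugeLawS i) (parBY_isGaugeLawB i) hu' U).mp h C

/-- ★★★ **… HENCE, FOR `θ < 1`, AT THE ORIGINAL `U`**: `Δ_{a,□}(U)` positive definite and invertible, `G_□(U) = Δ_{a,□}(U)⁻¹` positive definite, and the `L²`
bounds `(1 − θ)m·⟨B, G_□(U)B⟩ ≦ ⟨B, B⟩`, `((1 − θ)m)²·‖G_□(U)B‖² ≦ ‖B‖²` — «G(U^u) = R(u)G(U)R(u⁻¹)», «all the results of these theorems are gauge invariant»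
(n06-w1's coercive engines BY NAME at `U`). [cite: Balaban1985BackgroundPropagators, Thm 3.11 p.416, (3.86) p.407, (3.27) p.395, (3.34) p.396, Cor. 3.6 p.408, p.409 l.3–5] -/
theorem GACubeY_parSymY_bounds_of_relBoundGauge (hG : G ≤ B7Prop2Explicit.unitaryUnits (Matrix (Fin N) (Fin N) ℂ))
    {U : CfgY (Matrix (Fin N) (Fin N) ℂ) i} {u : GaugeY (Matrix (Fin N) (Fin N) ℂ) i} (hu : ∀ x, u x ∈ G) {m a b : ℝ} (hm : 0 < m) (ha : 0 ≤ a) (hb : 0 ≤ b)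
    (hco : ∀ C, m * trIP (fun _ => (1 : ℝ)) C C ≤
      trIP (fun _ => (1 : ℝ)) C (deltaACubeY i q (parSymY i) (parBY i) (fun _ _ => 1 : CfgY (Matrix (Fin N) (Fin N) ℂ) i) C))
    (hrel : ∀ B C, |trIP (fun _ => (1 : ℝ)) B
        ((deltaACubeY i q (parSymY i) (parBY i) (fun _ _ => 1 : CfgY (Matrix (Fin N) (Fin N) ℂ) i) -
          deltaACubeY i q (parSymY i) (parBY i) (gaugeY i u U)) C)| ≤
      Real.sqrt (trIP (fun _ => (1 : ℝ)) B B) * (a * Real.sqrt (trIP (fun _ => (1 : ℝ)) C C) +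
        b * Real.sqrt (trIP (fun _ => (1 : ℝ)) C (deltaACubeY i q (parSymY i) (parBY i) (fun _ _ => 1 : CfgY (Matrix (Fin N) (Fin N) ℂ) i) C))))
    (hθ : a / m + b / Real.sqrt m < 1) :
    PosDefTr (fun _ => (1 : ℝ)) (deltaACubeY i q (parSymY i) (parBY i) U) ∧ IsUnit (deltaACubeY i q (parSymY i) (parBY i) U) ∧
      PosDefTr (fun _ => (1 : ℝ)) (GACubeY i q (parSymY i) (parBY i) U) ∧
      (∀ B : FBondY i → Matrix (Fin N) (Fin N) ℂ,
        ((1 - (a / m + b / Real.sqrt m)) * m) * trIP (fun _ => (1 : ℝ)) B (GACubeY i q (parSymY i) (parBY i) U B) ≤ trIP (fun _ => (1 : ℝ)) B B) ∧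
      (∀ B : FBondY i → Matrix (Fin N) (Fin N) ℂ,
        ((1 - (a / m + b / Real.sqrt m)) * m) ^ 2 * trIP (fun _ => (1 : ℝ)) (GACubeY i q (parSymY i) (parBY i) U B) (GACubeY i q (parSymY i) (parBY i) U B) ≤
          trIP (fun _ => (1 : ℝ)) B B) := by
  have hw : ∀ _ : FBondY i, (0 : ℝ) < 1 := fun _ => one_pos
  have hm' : 0 < (1 - (a / m + b / Real.sqrt m)) * m := mul_pos (by linarith) hm
  have hco' := deltaACubeY_parSymY_coercive_of_relBoundGauge i q hG hu hm ha hb hco hrel hθ.le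
  have hpos : PosDefTr (fun _ => (1 : ℝ)) (deltaACubeY i q (parSymY i) (parBY i) U) := posDefTr_of_coercive hw hm' hco'
  refine ⟨hpos, isUnit_of_posDefTr hpos, posDefTr_ringInverse hpos, fun B => ?_, fun B => ?_⟩
  · exact trIP_ringInverse_le hw hm' hco' B
  · exact trIP_ringInverse_self_le hw hm' hco' B

end CubeLetters

end

end Literature.MathematicalPhysics.QuantumFieldTheory.Balaban1983to89.B9Thm311CubeLettersGCoerciveGauge
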